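import Mathlib
import Summits.KontsevichZagierPeriods.KontsevichZagierPeriods.Theorems.ScissorsTransportPolytopeTransportPoly
import Summits.KontsevichZagierPeriods.KontsevichZagierPeriods.Theorems.InverseLandauTateFamilyKernelTateAnchor
import Summits.KontsevichZagierPeriods.KontsevichZagierPeriods.Theorems.InverseLandauTateFamilyKernelStubExactFibreTwo
import Summits.KontsevichZagierPeriods.KontsevichZagierPeriods.Theorems.InverseLandauTateFamilyKernelStubLinMoments
import Summits.KontsevichZagierPeriods.KontsevichZagierPeriods.Theorems.InverseLandauTateFamilyKernelStubLinMomentsW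

/-!
# Crux `TateFamilyKernel` (stmt-KontsevichZagierPeriods-9130), line `Sketch` — stub `stub_pencilW`

META-LEMMA "`ϖ`-dependent numerators come for free" for TATE PENCILS `Q = 1 − ϖ·T(z)` in dimension
`2` (`T ∈ ℚ[z₁, z₂]` with `0 ≤ T ≤ 1/b` on the closed square; `X 0 = z₁`, `X 1 = z₂`,
`X (Fin.last 2) = ϖ`): a class theorem for `ϖ`-FREE numerators `P' ∈ ℚ[z₁, z₂]` (hypothesis
`hclass`) upgrades to numerators `P ∈ ℚ[z₁, z₂, ϖ]`.

* MOMENTS (`PencilW.moment_eq_zero`; the argument of the landed `stub_linMomentsW` for a general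
  `T`): with `M₀ = deg_ϖ P` and the reversal `P^rev(z, y) = Σ_d c_d z^{d'} y^{M₀ − d_ϖ}`, all
  moments `∫_{(0,1)²} P̃ T^j` of `P̃(z) = P^rev(z, T(z))` vanish; conversely vanishing moments give
  vanishing fibre integrals `∫ P'/(1 − ϖT) = Σ_j ϖ^j ∫ P'T^j = 0` on `(0,b)` (dominated
  convergence, `PencilW.integral_div_eq_zero_of_moments`), stable under `P̃ ↦ h(T)P̃`, `h ∈ ℚ[t]`.
* THE SCALAR: the naive decomposition `P(z,ϖ₀) = ϖ₀^{M₀}P̃ + (1 − ϖ₀T)G` carries the (in general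
  irrational) factor `ϖ₀^{M₀}`, and `KZ.relations` is only an additive subgroup. It is absorbed into
  the numerator: `ℚ[1/ϖ₀]` is a field containing `ϖ₀`, so `ϖ₀^{M₀} = h(1/ϖ₀)` with `h ∈ ℚ[t]`
  (`PencilW.exists_aeval_inv_eq_pow`), and the `ϖ`-free numerator is `P' = h(T)P̃ ∈ ℚ[z₁, z₂]`.
* DIVISION (`PencilW.exists_sub_eq_mul`): `F(z, y) − F(z, T(z)) = (y − T(z))·D(z, y)` for
  `F = h(X_ϖ)P^rev`; at `y = 1/ϖ₀` (where `F(z, 1/ϖ₀) = P(z, ϖ₀)`) this is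
  `P(z, ϖ₀) − P'(z) = (1 − ϖ₀T(z))·G(z)`, `G = (X_ϖ D)(z, 1/ϖ₀)` a polynomial in `z` over `ℚ[1/ϖ₀]`.
* GLUE: `P/Q(·,ϖ₀) = P'/Q(·,ϖ₀) + G` on the closed square; the first piece is a relation by
  `hclass`, the second has `∫_{(0,1)²} G = 0 − 0` and is a relation by `stub_exactFibreTwo` with the
  one-term certificate `G = ∂₁(antider G)` at the parameter `1/ϖ₀` (Baker on the boundary;
  `PencilW.poly_mem_relations`); the linearity move `KZ.cubicalLinGens` finishes.

References: Kontsevich–Zagier 2001, §1.2. Mathlib and landed files only (`LinMoments[W].*`,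
`antider`, `exists_isTameCube_fibre`, `stub_exactFibreTwo`); no named fact, no new definition.
-/

noncomputable section

open MeasureTheory Set MvPolynomial
open Literature.NumberTheory.Transcendental
open Summit.KontsevichZagierPeriods.ScissorsTransport.PolytopeTransport (antider pderiv_antider)

namespace Summit.KontsevichZagierPeriods.InverseLandau.TateFamilyKernel.Descent

namespace PencilW

/-! ### The pencil `1 − ϖT` on the square -/

/-- For `ϖ ∈ (0,b)`: `ϖ/b < 1`. [folklore] -/
theorem mul_one_div_lt_one {b ϖ : ℝ} (hb : 0 < b) (hϖ : ϖ ∈ Ioo 0 b) : ϖ * (1 / b) < 1 := by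
  rw [mul_one_div, div_lt_one hb]
  exact hϖ.2

/-- On the open square, `0 ≤ T ≤ 1/b`. [folklore] -/
theorem T_bounds {T : MvPolynomial (Fin 2) ℚ} {b : ℝ} (hb : 0 < b)
    (hT : ∀ z : Fin 2 → ℝ, (∀ t, z t ∈ Icc (0 : ℝ) 1) → 0 ≤ aeval z T ∧ aeval z T * b ≤ 1)
    {z : Fin 2 → ℝ} (hz : z ∈ Set.pi Set.univ (fun _ : Fin 2 => Ioo (0 : ℝ) 1)) :
    0 ≤ aeval z T ∧ aeval z T ≤ 1 / b := by
  have h := hT z fun t => ⟨((mem_univ_pi.mp hz) t).1.le, ((mem_univ_pi.mp hz) t).2.le⟩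
  exact ⟨h.1, by rw [le_div_iff₀ hb]; exact h.2⟩

/-- The pencil in polynomial form: `(1 − X_ϖ · T)(z, ϖ) = 1 − ϖ T(z)`. [folklore] -/
theorem aeval_snoc_pencil (T : MvPolynomial (Fin 2) ℚ) (z : Fin 2 → ℝ) (ϖ : ℝ) :
    aeval (Fin.snoc z ϖ : Fin (2 + 1) → ℝ)
        (1 - X (Fin.last 2) * rename Fin.castSucc T : MvPolynomial (Fin (2 + 1)) ℚ) =
      1 - ϖ * aeval z T := by
  rw [map_sub, map_one, map_mul, aeval_X, Fin.snoc_last, LinMoments.aeval_snoc_rename_castSucc]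

/-! ### The reversed numerator and its moments -/

/-- **Evaluation of the reversal** `P^rev = Σ_d c_d X^{d'} X_ϖ^{M₀ − d_ϖ}` at a real point
`(z, y)`. [folklore] -/
theorem aeval_rev (P : MvPolynomial (Fin (2 + 1)) ℚ) (M₀ : ℕ) (z : Fin 2 → ℝ) (y : ℝ) :
    aeval (Fin.snoc z y : Fin (2 + 1) → ℝ)
        (∑ d ∈ P.support, C (coeff d P) * (∏ i : Fin 2, X (Fin.castSucc i) ^ d (Fin.castSucc i)) *
          X (Fin.last 2) ^ (M₀ - d (Fin.last 2))) =
      ∑ d ∈ P.support, ((coeff d P : ℚ) : ℝ) * (∏ i : Fin 2, z i ^ d (Fin.castSucc i)) *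
        y ^ (M₀ - d (Fin.last 2)) := by
  simp only [map_sum, map_mul, map_pow, map_prod, aeval_X, aeval_C, Fin.snoc_castSucc,
    Fin.snoc_last, eq_ratCast]

/-- **Moments of the reversed numerator.** If `0 ≤ T ≤ 1/b` on the square and the fibre
integrals `∫_{(0,1)²} P(·,ϖ)/(1 − ϖT)` vanish on `(0,b)`, then every moment `∫_{(0,1)²} P̃ T^j` of
`P̃(z) = P^rev(z, T(z))` (`M₀ = deg_ϖ P`) vanishes: `P/(1 − ϖT) = Σ_M F_M ϖ^M` on the square with
`F_M = Σ_{d_ϖ ≤ M} c_d z^{d'} T^{M − d_ϖ}`, `|F_M| ≤ K b^{-M}`, so all `∫ F_M = 0`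
(`LinMomentsW.integral_coeff_eq_zero`), and `F_{j + M₀} = P̃ T^j`.
[cite: KontsevichZagier2001, §1.2] -/
theorem moment_eq_zero {T : MvPolynomial (Fin 2) ℚ} {b : ℝ} (hb : 0 < b)
    (hT : ∀ z : Fin 2 → ℝ, (∀ t, z t ∈ Icc (0 : ℝ) 1) → 0 ≤ aeval z T ∧ aeval z T * b ≤ 1)
    (P : MvPolynomial (Fin (2 + 1)) ℚ)
    (hvan : ∀ ϖ ∈ Ioo 0 b, ∫ z in Set.pi Set.univ (fun _ : Fin 2 => Ioo (0 : ℝ) 1),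
      aeval (Fin.snoc z ϖ : Fin (2 + 1) → ℝ) P / (1 - ϖ * aeval z T) = 0) (j : ℕ) :
    ∫ z in Set.pi Set.univ (fun _ : Fin 2 => Ioo (0 : ℝ) 1),
      (∑ d ∈ P.support, ((coeff d P : ℚ) : ℝ) * (∏ i : Fin 2, z i ^ d (Fin.castSucc i)) *
        aeval z T ^ (P.degreeOf (Fin.last 2) - d (Fin.last 2))) * aeval z T ^ j = 0 := by
  have hR : (0 : ℝ) < 1 / b := one_div_pos.mpr hb
  have hc := LinMoments.continuous_aeval T
  have he : ∀ d ∈ P.support, d (Fin.last 2) ≤ P.degreeOf (Fin.last 2) := fun d hd =>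
    monomial_le_degreeOf _ hd
  -- every coefficient `∫ F_M` of the expansion of the (vanishing) fibre integral vanishes
  have hν : ∀ M : ℕ, (∫ z in Set.pi Set.univ (fun _ : Fin 2 => Ioo (0 : ℝ) 1),
      ∑ d ∈ P.support, if d (Fin.last 2) ≤ M then
        ((coeff d P : ℚ) : ℝ) * (∏ i : Fin 2, z i ^ d (Fin.castSucc i)) *
          aeval z T ^ (M - d (Fin.last 2)) else 0) = 0 := by
    refine LinMomentsW.integral_coeff_eq_zero
      (F := fun M z => ∑ d ∈ P.support, if d (Fin.last 2) ≤ M then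
        ((coeff d P : ℚ) : ℝ) * (∏ i : Fin 2, z i ^ d (Fin.castSucc i)) *
          aeval z T ^ (M - d (Fin.last 2)) else 0)
      (g := fun ϖ z => aeval (Fin.snoc z ϖ : Fin (2 + 1) → ℝ) P / (1 - ϖ * aeval z T))
      (K := ∑ d ∈ P.support, |((coeff d P : ℚ) : ℝ)| * ((1 / b) ^ d (Fin.last 2))⁻¹)
      hR hb (fun M => ?_) (fun M z hz => ?_) (fun ϖ hϖ => mul_one_div_lt_one hb hϖ)
      (fun ϖ hϖ z hz => ?_) hvan
    · refine continuous_finsetSum _ fun d _ => ?_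
      split_ifs
      · fun_prop
      · exact continuous_const
    · have hTz := T_bounds hb hT hz
      exact LinMomentsW.abs_sum_shift_le P.support
        (fun d => ((coeff d P : ℚ) : ℝ) * ∏ i : Fin 2, z i ^ d (Fin.castSucc i))
        (fun d => |((coeff d P : ℚ) : ℝ)|) (fun d => d (Fin.last 2)) hR hTz.1 hTz.2
        (fun d _ => by
          rw [abs_mul, abs_of_nonneg (LinMomentsW.monomial_bounds hz d).1]
          exact mul_le_of_le_one_right (abs_nonneg _) (LinMomentsW.monomial_bounds hz d).2) M
    · have hTz := T_bounds hb hT hz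
      rw [LinMomentsW.aeval_snoc_eq_sum, div_eq_mul_inv]
      exact LinMomentsW.hasSum_sum_shift P.support
        (fun d => ((coeff d P : ℚ) : ℝ) * ∏ i : Fin 2, z i ^ d (Fin.castSucc i))
        (fun d => d (Fin.last 2)) (mul_nonneg hϖ.1.le hTz.1)
        (lt_of_le_of_lt (mul_le_mul_of_nonneg_left hTz.2 hϖ.1.le) (mul_one_div_lt_one hb hϖ))
  -- the `(j + M₀)`-th coefficient is the `j`-th moment of `P̃`
  refine Eq.trans (setIntegral_congr_fun LinMoments.measurableSet_sq fun z _ => ?_)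
    (hν (j + P.degreeOf (Fin.last 2)))
  exact (LinMomentsW.sum_shift_eq P.support
    (fun d => ((coeff d P : ℚ) : ℝ) * ∏ i : Fin 2, z i ^ d (Fin.castSucc i))
    (fun d => d (Fin.last 2)) (aeval z T) he j).symm

/-- **From moments to fibre integrals.** If `0 ≤ T ≤ 1/b` on the square and all moments
`∫_{(0,1)²} P' T^j` vanish, then `∫_{(0,1)²} P'/(1 − ϖT) = 0` for every `ϖ ∈ (0,b)`: on the square
`P'/(1 − ϖT) = Σ_j P' T^j ϖ^j` with the summable uniform domination `K (ϖ/b)^j`, so dominated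
convergence for series gives `∫ P'/(1 − ϖT) = Σ_j (∫ P' T^j) ϖ^j = 0`. [folklore] -/
theorem integral_div_eq_zero_of_moments {T : MvPolynomial (Fin 2) ℚ} {b : ℝ} (hb : 0 < b)
    (hT : ∀ z : Fin 2 → ℝ, (∀ t, z t ∈ Icc (0 : ℝ) 1) → 0 ≤ aeval z T ∧ aeval z T * b ≤ 1)
    (P' : MvPolynomial (Fin 2) ℚ)
    (hmom : ∀ j : ℕ, ∫ z in Set.pi Set.univ (fun _ : Fin 2 => Ioo (0 : ℝ) 1),
      aeval z P' * aeval z T ^ j = 0) {ϖ : ℝ} (hϖ : ϖ ∈ Ioo 0 b) :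
    ∫ z in Set.pi Set.univ (fun _ : Fin 2 => Ioo (0 : ℝ) 1),
      aeval z P' / (1 - ϖ * aeval z T) = 0 := by
  obtain ⟨K, hK⟩ :=
    (isCompact_Icc : IsCompact (Icc (0 : Fin 2 → ℝ) 1)).exists_bound_of_continuousOn
      (LinMoments.continuous_aeval P').continuousOn
  have hq0 : 0 ≤ ϖ * (1 / b) := mul_nonneg hϖ.1.le (one_div_pos.mpr hb).le
  have hq1 : ϖ * (1 / b) < 1 := mul_one_div_lt_one hb hϖ
  have hsum : HasSum (fun j : ℕ => (∫ z in Set.pi Set.univ (fun _ : Fin 2 => Ioo (0 : ℝ) 1),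
      aeval z P' * aeval z T ^ j) * ϖ ^ j)
      (∫ z in Set.pi Set.univ (fun _ : Fin 2 => Ioo (0 : ℝ) 1),
        aeval z P' / (1 - ϖ * aeval z T)) := by
    simp_rw [← integral_mul_const]
    refine hasSum_integral_of_dominated_convergence (fun j _ => K * (ϖ * (1 / b)) ^ j)
      (fun j => ?_) (fun j => ?_) ?_ ?_ ?_
    · exact (((LinMoments.continuous_aeval P').mul ((LinMoments.continuous_aeval T).pow j)).mul
        continuous_const).aestronglyMeasurable
    · refine ae_restrict_of_forall_mem LinMoments.measurableSet_sq fun z hz => ?_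
      have hTz := T_bounds hb hT hz
      have hPz := hK z (LinMoments.sq_subset_Icc hz)
      rw [norm_mul, norm_mul, norm_pow, norm_pow, Real.norm_of_nonneg hTz.1,
        Real.norm_of_nonneg hϖ.1.le, mul_assoc, ← mul_pow]
      refine mul_le_mul hPz (pow_le_pow_left₀ (mul_nonneg hTz.1 hϖ.1.le) ?_ j)
        (pow_nonneg (mul_nonneg hTz.1 hϖ.1.le) j) ((norm_nonneg _).trans hPz)
      rw [mul_comm]
      exact mul_le_mul_of_nonneg_left hTz.2 hϖ.1.le
    · exact Filter.Eventually.of_forall fun z =>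
        (summable_geometric_of_lt_one hq0 hq1).mul_left _
    · simp_rw [tsum_mul_left, tsum_geometric_of_lt_one hq0 hq1]
      exact integrableOn_const LinMomentsW.volume_sq_lt_top.ne
    · refine ae_restrict_of_forall_mem LinMoments.measurableSet_sq fun z hz => ?_
      have hTz := T_bounds hb hT hz
      have hr1 : ϖ * aeval z T < 1 :=
        lt_of_le_of_lt (mul_le_mul_of_nonneg_left hTz.2 hϖ.1.le) hq1
      simpa only [mul_pow, div_eq_mul_inv, mul_assoc, mul_comm, mul_left_comm] using
        (hasSum_geometric_of_lt_one (mul_nonneg hϖ.1.le hTz.1) hr1).mul_left (aeval z P')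
  simp only [hmom, zero_mul] at hsum
  exact hsum.unique hasSum_zero

/-- **Moments are stable under `ℚ[T]`**: if all `∫ P̃ T^j` vanish, so do all `∫ h(T)·P̃·T^j`
(`h ∈ ℚ[t]`; expand `h(T) = Σ_i h_i T^i`, each term continuous hence integrable). [folklore] -/
theorem moment_mul_eq_zero {T : MvPolynomial (Fin 2) ℚ} (Pt : MvPolynomial (Fin 2) ℚ)
    (h : Polynomial ℚ)
    (hmom : ∀ j : ℕ, ∫ z in Set.pi Set.univ (fun _ : Fin 2 => Ioo (0 : ℝ) 1),
      aeval z Pt * aeval z T ^ j = 0) (j : ℕ) :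
    ∫ z in Set.pi Set.univ (fun _ : Fin 2 => Ioo (0 : ℝ) 1),
      aeval z (Polynomial.aeval T h * Pt) * aeval z T ^ j = 0 := by
  have hexp : ∀ z : Fin 2 → ℝ, aeval z (Polynomial.aeval T h * Pt) * aeval z T ^ j =
      ∑ i ∈ Finset.range (h.natDegree + 1),
        (h.coeff i : ℝ) * (aeval z Pt * aeval z T ^ (i + j)) := by
    intro z
    rw [map_mul, ← Polynomial.aeval_algHom_apply, Polynomial.aeval_eq_sum_range, Finset.sum_mul,
      Finset.sum_mul]
    refine Finset.sum_congr rfl fun i _ => ?_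
    rw [Algebra.smul_def, eq_ratCast, pow_add]
    ring
  simp_rw [hexp]
  rw [integral_finsetSum _ fun i _ => ?_]
  · refine Finset.sum_eq_zero fun i _ => ?_
    rw [integral_const_mul, hmom (i + j), mul_zero]
  · exact ((continuous_const.mul ((LinMoments.continuous_aeval Pt).mul
      ((LinMoments.continuous_aeval T).pow (i + j)))).integrableOn_Icc.mono_set
        LinMoments.sq_subset_Icc)

/-! ### The scalar `ϖ₀^{M}` and the division by `X_ϖ − T` -/

/-- **The scalar `ϖ₀^M` is a `ℚ`-polynomial in `1/ϖ₀`** for `ϖ₀` real algebraic: `ℚ[1/ϖ₀]` is a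
field (`IsIntegral.inv_mem_adjoin`), so it contains `ϖ₀` and its powers. [folklore] -/
theorem exists_aeval_inv_eq_pow {ϖ₀ : ℝ} (halg : IsAlgebraic ℚ ϖ₀) (M : ℕ) :
    ∃ h : Polynomial ℚ, Polynomial.aeval ϖ₀⁻¹ h = ϖ₀ ^ M := by
  have hmem := Subalgebra.pow_mem _ (halg.inv.isIntegral (K := ℚ)).inv_mem_adjoin M
  rwa [inv_inv, Algebra.adjoin_singleton_eq_range_aeval, AlgHom.mem_range] at hmem

/-- **Division by `X_ϖ − T`.** For every `F ∈ ℚ[z₁, z₂, ϖ]` there is `D ∈ ℚ[z₁, z₂, ϖ]` with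
`F(z, y) − F(z, T(z)) = (y − T(z))·D(z, y)` at all real points (induction on `F`). [folklore] -/
theorem exists_sub_eq_mul (T : MvPolynomial (Fin 2) ℚ) (F : MvPolynomial (Fin (2 + 1)) ℚ) :
    ∃ D : MvPolynomial (Fin (2 + 1)) ℚ, ∀ (z : Fin 2 → ℝ) (y : ℝ),
      aeval (Fin.snoc z y : Fin (2 + 1) → ℝ) F -
          aeval (Fin.snoc z (aeval z T) : Fin (2 + 1) → ℝ) F =
        (y - aeval z T) * aeval (Fin.snoc z y : Fin (2 + 1) → ℝ) D := by
  induction F using MvPolynomial.induction_on with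
  | C a => exact ⟨0, fun z y => by simp⟩
  | add p q hp hq =>
    obtain ⟨D₁, h₁⟩ := hp
    obtain ⟨D₂, h₂⟩ := hq
    refine ⟨D₁ + D₂, fun z y => ?_⟩
    simp only [map_add]
    linear_combination h₁ z y + h₂ z y
  | mul_X p i hp =>
    obtain ⟨D₁, h₁⟩ := hp
    refine Fin.lastCases ?_ (fun j => ?_) i
    · refine ⟨D₁ * X (Fin.last 2) + p - (X (Fin.last 2) - rename Fin.castSucc T) * D₁,
        fun z y => ?_⟩
      simp only [map_mul, map_add, map_sub, aeval_X, Fin.snoc_last,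
        LinMoments.aeval_snoc_rename_castSucc]
      linear_combination (aeval z T) * h₁ z y
    · refine ⟨D₁ * X (Fin.castSucc j), fun z y => ?_⟩
      simp only [map_mul, aeval_X, Fin.snoc_castSucc]
      linear_combination (z j) * h₁ z y

/-! ### Polynomial integrands with vanishing integral -/

/-- **A polynomial integrand with real-algebraic coefficients and vanishing integral is a
relation.** For `G ∈ ℚ[z₁, z₂, ϖ]` and a real-algebraic `y₀` with `∫_{(0,1)²} G(·, y₀) = 0`, every
tame cube representation of `z ↦ G(z, y₀)` is a relation: `G = ∂₁(antider G)` is a one-term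
Griffiths certificate with denominator `1`, so `stub_exactFibreTwo` applies (the boundary term is
a one-variable polynomial with real-algebraic coefficients — Baker).
[cite: KontsevichZagier2001, §1.2] -/
theorem poly_mem_relations (G : MvPolynomial (Fin (2 + 1)) ℚ) {y₀ : ℝ} (halg : IsAlgebraic ℚ y₀)
    (hint : ∫ z in Set.pi Set.univ (fun _ : Fin 2 => Ioo (0 : ℝ) 1),
      aeval (Fin.snoc z y₀ : Fin (2 + 1) → ℝ) G = 0)
    (Φ : KZ.IntegralRep 2) (hΦ : Φ.IsTameCube)
    (hΦi : ∀ z ∈ KZ.cube 2, Φ.integrand z = aeval (Fin.snoc z y₀ : Fin (2 + 1) → ℝ) G) :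
    KZ.of Φ ∈ KZ.relations := by
  refine stub_exactFibreTwo 1 (fun _ => 0) G 1 (fun _ => antider G) (fun _ => 1) y₀ halg
    (fun w _ => by simp) (fun _ w _ => by simp) (fun w _ => ?_) ?_ Φ hΦ fun z hz => ?_
  · simp only [Fin.sum_univ_one, Fin.castSucc_zero, pderiv_antider, Derivation.map_one_eq_zero,
      mul_one, mul_zero, sub_zero, one_pow, map_one, div_one]
  · simp_rw [map_one, div_one]
    exact hint
  · rw [hΦi z hz, map_one, div_one]

end PencilW

open PencilW in
/-- **Tate pencils: `ϖ`-dependent numerators come for free** (stub `stub_pencilW` of the crux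
`TateFamilyKernel`, line `Sketch`). Let `T ∈ ℚ[z₁, z₂]` with `0 ≤ T ≤ 1/b` on the closed square and
suppose the CLASS THEOREM for `ϖ`-free numerators `P' ∈ ℚ[z₁, z₂]` (identically vanishing fibre
integrals `∫_{(0,1)²} P'/(1 − ϖT)` on `(0,b)` ⇒ every tame cube representation of every
real-algebraic fibre is a relation). Then the same holds for every `P ∈ ℚ[z₁, z₂, ϖ]`: the reversal
`P̃(z) = T^{M₀}P(z, 1/T)` (`M₀ = deg_ϖ P`) has vanishing moments against all powers of `T`,
`ϖ₀^{M₀} = h(1/ϖ₀)` for some `h ∈ ℚ[t]` (`ϖ₀` algebraic), the `ϖ`-free `P' = h(T)P̃` again has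
identically vanishing fibre integrals, and `P(·,ϖ₀)/(1 − ϖ₀T) = P'/(1 − ϖ₀T) + G` with `G` a
polynomial in `z` over `ℚ[1/ϖ₀]` of vanishing integral — a relation by Stokes + Baker
(`stub_exactFibreTwo`); the linearity move glues. [cite: KontsevichZagier2001, §1.2] -/
theorem stub_pencilW (T : MvPolynomial (Fin 2) ℚ) (b : ℝ) (hb : 0 < b)
    (hT : ∀ z : Fin 2 → ℝ, (∀ t, z t ∈ Icc (0 : ℝ) 1) → 0 ≤ aeval z T ∧ aeval z T * b ≤ 1)
    (hclass : ∀ P' : MvPolynomial (Fin 2) ℚ,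
      (∀ ϖ ∈ Ioo 0 b, ∫ z in Set.pi Set.univ (fun _ : Fin 2 => Ioo (0 : ℝ) 1),
        aeval z P' / (1 - ϖ * aeval z T) = 0) →
      ∀ ϖ₀ : ℝ, IsAlgebraic ℚ ϖ₀ → ϖ₀ ∈ Ioo 0 b → ∀ Φ : KZ.IntegralRep 2, Φ.IsTameCube →
        (∀ z ∈ KZ.cube 2, Φ.integrand z = aeval z P' / (1 - ϖ₀ * aeval z T)) → KZ.of Φ ∈ KZ.relations)
    (P : MvPolynomial (Fin (2 + 1)) ℚ)
    (hvan : ∀ ϖ ∈ Ioo 0 b, ∫ z in Set.pi Set.univ (fun _ : Fin 2 => Ioo (0 : ℝ) 1),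
      aeval (Fin.snoc z ϖ : Fin (2 + 1) → ℝ) P / (1 - ϖ * aeval z T) = 0)
    (ϖ₀ : ℝ) (halg : IsAlgebraic ℚ ϖ₀) (hϖ₀ : ϖ₀ ∈ Ioo 0 b)
    (Φ : KZ.IntegralRep 2) (hΦ : Φ.IsTameCube)
    (hΦi : ∀ z ∈ KZ.cube 2, Φ.integrand z = aeval (Fin.snoc z ϖ₀ : Fin (2 + 1) → ℝ) P / (1 - ϖ₀ * aeval z T)) :
    KZ.of Φ ∈ KZ.relations := by
  have hp : ϖ₀ ≠ 0 := hϖ₀.1.ne'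
  have hpinv : ϖ₀ * ϖ₀⁻¹ = 1 := mul_inv_cancel₀ hp
  have hyalg : IsAlgebraic ℚ ϖ₀⁻¹ := halg.inv
  -- the pencil does not vanish on the closed square at `ϖ₀`: `ϖ₀T ≤ ϖ₀/b < 1`
  have hQ : ∀ z ∈ KZ.cube 2, 1 - ϖ₀ * aeval z T ≠ 0 := fun z hz =>
    (sub_pos.mpr ((mul_le_mul_of_nonneg_left ((le_div_iff₀ hb).mpr (hT z fun t => hz t).2)
      hϖ₀.1.le).trans_lt (mul_one_div_lt_one hb hϖ₀))).ne'
  have hQp : ∀ z ∈ KZ.cube 2, aeval (Fin.snoc z ϖ₀ : Fin (2 + 1) → ℝ)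
      (1 - X (Fin.last 2) * rename Fin.castSucc T : MvPolynomial (Fin (2 + 1)) ℚ) ≠ 0 :=
    fun z hz => by simpa only [aeval_snoc_pencil] using hQ z hz
  -- Step 1: the reversal `Prev` of `P` in `ϖ`, the substitution `X_ϖ ↦ T`, the moments of `P̃`
  have he : ∀ d ∈ P.support, d (Fin.last 2) ≤ P.degreeOf (Fin.last 2) := fun d hd =>
    monomial_le_degreeOf _ hd
  obtain ⟨Prev, hPrev⟩ : ∃ Prev : MvPolynomial (Fin (2 + 1)) ℚ, Prev = ∑ d ∈ P.support,
      C (coeff d P) * (∏ i : Fin 2, X (Fin.castSucc i) ^ d (Fin.castSucc i)) *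
        X (Fin.last 2) ^ (P.degreeOf (Fin.last 2) - d (Fin.last 2)) := ⟨_, rfl⟩
  obtain ⟨τ, hτ⟩ : ∃ τ : Fin (2 + 1) → MvPolynomial (Fin 2) ℚ,
      τ = Fin.snoc (fun i => X i) T := ⟨_, rfl⟩
  have hτe : ∀ (F : MvPolynomial (Fin (2 + 1)) ℚ) (z : Fin 2 → ℝ),
      aeval z (bind₁ τ F) = aeval (Fin.snoc z (aeval z T) : Fin (2 + 1) → ℝ) F := fun F z => by
    rw [aeval_bind₁]
    exact congrArg (fun v : Fin (2 + 1) → ℝ => aeval v F)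
      (funext fun l => by
        induction l using Fin.lastCases <;>
          simp only [hτ, Fin.snoc_last, Fin.snoc_castSucc, aeval_X])
  have hmom : ∀ j : ℕ, ∫ z in Set.pi Set.univ (fun _ : Fin 2 => Ioo (0 : ℝ) 1),
      aeval z (bind₁ τ Prev) * aeval z T ^ j = 0 := fun j => by
    simp only [hτe, hPrev, aeval_rev]
    exact moment_eq_zero hb hT P hvan j
  -- the reversal identity `Prev(z, 1/ϖ₀) = ϖ₀^{-M₀} P(z, ϖ₀)`
  have hPrev_y : ∀ z : Fin 2 → ℝ, aeval (Fin.snoc z ϖ₀⁻¹ : Fin (2 + 1) → ℝ) Prev =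
      ϖ₀⁻¹ ^ P.degreeOf (Fin.last 2) * aeval (Fin.snoc z ϖ₀ : Fin (2 + 1) → ℝ) P := fun z => by
    rw [hPrev, aeval_rev, LinMomentsW.aeval_snoc_eq_sum]
    simpa only [inv_inv] using LinMomentsW.sum_rev_eq P.support
      (fun d => ((coeff d P : ℚ) : ℝ) * ∏ i : Fin 2, z i ^ d (Fin.castSucc i))
      (fun d => d (Fin.last 2)) (inv_ne_zero hp) he
  -- Step 2: the scalar `ϖ₀^{M₀} = h(1/ϖ₀)` and the `ϖ`-free numerator `P' = h(T)·P̃`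
  obtain ⟨h, hh⟩ := exists_aeval_inv_eq_pow halg (P.degreeOf (Fin.last 2))
  have hP'van : ∀ ϖ ∈ Ioo 0 b, ∫ z in Set.pi Set.univ (fun _ : Fin 2 => Ioo (0 : ℝ) 1),
      aeval z (Polynomial.aeval T h * bind₁ τ Prev) / (1 - ϖ * aeval z T) = 0 := fun ϖ hϖ =>
    integral_div_eq_zero_of_moments hb hT _ (moment_mul_eq_zero _ h hmom) hϖ
  have hP'e : ∀ z : Fin 2 → ℝ, aeval z (Polynomial.aeval T h * bind₁ τ Prev) =
      aeval (Fin.snoc z (aeval z T) : Fin (2 + 1) → ℝ)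
        (Polynomial.aeval (X (Fin.last 2)) h * Prev) := fun z => by
    rw [map_mul, map_mul, ← Polynomial.aeval_algHom_apply, ← Polynomial.aeval_algHom_apply,
      aeval_X, Fin.snoc_last, hτe]
  have hFe : ∀ z : Fin 2 → ℝ, aeval (Fin.snoc z ϖ₀⁻¹ : Fin (2 + 1) → ℝ)
      (Polynomial.aeval (X (Fin.last 2)) h * Prev) = aeval (Fin.snoc z ϖ₀ : Fin (2 + 1) → ℝ) P :=
    fun z => by
    rw [map_mul, ← Polynomial.aeval_algHom_apply, aeval_X, Fin.snoc_last, hh, hPrev_y,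
      ← mul_assoc, ← mul_pow, hpinv, one_pow, one_mul]
  -- Step 3: division by `X_ϖ − T`: `P(z, ϖ₀) = P'(z) + (1 − ϖ₀T(z))·G(z)`, `G = (X_ϖ D)(z, 1/ϖ₀)`
  obtain ⟨D, hD⟩ := exists_sub_eq_mul T (Polynomial.aeval (X (Fin.last 2)) h * Prev)
  have hGe : ∀ z : Fin 2 → ℝ, aeval (Fin.snoc z ϖ₀⁻¹ : Fin (2 + 1) → ℝ) (X (Fin.last 2) * D) =
      ϖ₀⁻¹ * aeval (Fin.snoc z ϖ₀⁻¹ : Fin (2 + 1) → ℝ) D := fun z => by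
    rw [map_mul, aeval_X, Fin.snoc_last]
  have hfib : ∀ z : Fin 2 → ℝ, aeval (Fin.snoc z ϖ₀ : Fin (2 + 1) → ℝ) P =
      aeval z (Polynomial.aeval T h * bind₁ τ Prev) +
        (1 - ϖ₀ * aeval z T) * aeval (Fin.snoc z ϖ₀⁻¹ : Fin (2 + 1) → ℝ) (X (Fin.last 2) * D) :=
    fun z => by
    have h3 := hD z ϖ₀⁻¹
    rw [hFe, ← hP'e] at h3
    rw [hGe]
    linear_combination h3 + (aeval z T * aeval (Fin.snoc z ϖ₀⁻¹ : Fin (2 + 1) → ℝ) D) * hpinv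
  -- Step 4: `∫_□ G = ∫_□ P(·,ϖ₀)/Q − ∫_□ P'/Q = 0 − 0` (integrands continuous on the closed square)
  have hsq : Set.pi Set.univ (fun _ : Fin 2 => Ioo (0 : ℝ) 1) ⊆ KZ.cube 2 := fun z hz i =>
    ⟨((mem_univ_pi.mp hz) i).1.le, ((mem_univ_pi.mp hz) i).2.le⟩
  have hInt : ∀ R : MvPolynomial (Fin (2 + 1)) ℚ, IntegrableOn (fun z : Fin 2 → ℝ =>
      aeval (Fin.snoc z ϖ₀ : Fin (2 + 1) → ℝ) R / (1 - ϖ₀ * aeval z T))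
      (Set.pi Set.univ (fun _ : Fin 2 => Ioo (0 : ℝ) 1)) := fun R => by
    simpa only [aeval_snoc_pencil] using (ContinuousOn.integrableOn_compact KZ.isCompact_cube
      fun z hz => (analyticAt_aeval_div_aeval_snoc ϖ₀ R _
        (hQp z hz)).continuousAt.continuousWithinAt).mono_set hsq
  have hGint : ∫ z in Set.pi Set.univ (fun _ : Fin 2 => Ioo (0 : ℝ) 1),
      aeval (Fin.snoc z ϖ₀⁻¹ : Fin (2 + 1) → ℝ) (X (Fin.last 2) * D) = 0 := by
    have h1 : (∫ z in Set.pi Set.univ (fun _ : Fin 2 => Ioo (0 : ℝ) 1),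
        aeval (Fin.snoc z ϖ₀⁻¹ : Fin (2 + 1) → ℝ) (X (Fin.last 2) * D)) =
        ∫ z in Set.pi Set.univ (fun _ : Fin 2 => Ioo (0 : ℝ) 1),
          (aeval (Fin.snoc z ϖ₀ : Fin (2 + 1) → ℝ) P / (1 - ϖ₀ * aeval z T) -
            aeval z (Polynomial.aeval T h * bind₁ τ Prev) / (1 - ϖ₀ * aeval z T)) :=
      setIntegral_congr_fun LinMoments.measurableSet_sq fun z hz => by
        rw [← sub_div, eq_div_iff (hQ z (hsq hz)), hfib z]
        ring
    have h2 := hInt (rename Fin.castSucc (Polynomial.aeval T h * bind₁ τ Prev))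
    simp only [LinMoments.aeval_snoc_rename_castSucc] at h2
    rw [h1, integral_sub (hInt P) h2, hvan ϖ₀ hϖ₀, hP'van ϖ₀ hϖ₀, sub_zero]
  -- Step 5: the tame pieces `P'/Q(·,ϖ₀)` (relation by `hclass`), `G` (`poly_mem_relations`); glue
  obtain ⟨Φ₁, hΦ₁, hΦ₁i⟩ := exists_isTameCube_fibre
    (rename Fin.castSucc (Polynomial.aeval T h * bind₁ τ Prev)) _ halg hQp
  obtain ⟨Φ₂, hΦ₂, hΦ₂i⟩ :=
    exists_isTameCube_fibre (X (Fin.last 2) * D) 1 hyalg fun z _ => by simp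
  have hrel₁ : KZ.of Φ₁ ∈ KZ.relations := hclass _ hP'van ϖ₀ halg hϖ₀ Φ₁ hΦ₁ fun z _ => by
    simp only [hΦ₁i, aeval_snoc_pencil, LinMoments.aeval_snoc_rename_castSucc]
  have hrel₂ : KZ.of Φ₂ ∈ KZ.relations :=
    poly_mem_relations (X (Fin.last 2) * D) hyalg hGint Φ₂ hΦ₂ fun z _ => by
      simp only [hΦ₂i, map_one, div_one]
  have hlin : KZ.of Φ - KZ.of Φ₁ - KZ.of Φ₂ ∈ KZ.relations :=
    KZ.cubicalLinGens_subset_relations (KZ.mem_cubicalLinGens hΦ hΦ₁ hΦ₂ fun z hz => by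
      rw [Pi.add_apply, hΦi z hz, hΦ₁i, hΦ₂i]
      simp only [aeval_snoc_pencil, LinMoments.aeval_snoc_rename_castSucc, map_one, div_one]
      rw [hfib z, add_div, mul_div_cancel_left₀ _ (hQ z hz)])
  rw [show KZ.of Φ = KZ.of Φ - KZ.of Φ₁ - KZ.of Φ₂ + KZ.of Φ₁ + KZ.of Φ₂ by abel]
  exact KZ.relations.add_mem (KZ.relations.add_mem hlin hrel₁) hrel₂

end Summit.KontsevichZagierPeriods.InverseLandau.TateFamilyKernel.Descent
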